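import Summits.QuantumFields.YangMills.Theorems.PencilRigidityPlanarToEuclideanSO4
import Literature.MathematicalPhysics.QuantumFieldTheory.QCDTorusAxisPermutation
import HarnessLib

/-!
# Proof-side vocabulary of the line `registered` (birth, reshape r1) for crux `RotationRestoration`
(item stmt-QuantumFields-8840; routes GapBuysCauchyRate / FourMirrorsWardE1 / DiagonalSpine, sub-problem QCD)

D-0016 `<RouteSlug>Defs` file (route-posited proof-side objects; nothing here is a named fact or a claim):
the four pieces of vocabulary of the skeleton `Cruxes/RotationRestoration/Lines/birth.lean` and the six
registered STUB STATEMENTS as `Prop`-valued definitions, so that every stub worker proves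
`theorem stub_X : X` against ONE shared copy (no duplicated declarations across the helper files) and the
final sorry-free skeleton imports them all.

* `IsLatticeLimit sch S` — the convergence clause of the crux verbatim (the lattice TIE);
* `IsSeparated f` — compactly supported real one-point test functions with pairwise disjoint supports;
* `axisPerm π` — the axis permutation `π` as a linear isometry of `ℝ⁴` (`piLpCongrLeft`);
* `IsPlanar R` — determinant one and `R e₂ = e₂`, `R e₃ = e₃` (the coordinate `SO(2)₀₁`);
* the statements `LatticePermCovariance` (S1a), `LatticeInvariancePassesToLimit` (S1b), `EvenPermSpinor`
  (S1c), `PlanarWardOnSeparatedTensors` (S2, the hard stub), `SeparatedTensorsTotal` (S3),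
  `SO4FromCoordinatePlanes` (S4) — docstrings say what each asserts and why it is expected to hold; their
  proofs land in sibling files `GapBuysCauchyRateRotationRestoration<Stub>.lean` (`--supports stmt-QuantumFields-8840`);
* the proof of S4, `stub_so4FromCoordinatePlanes` (Mathlib + the landed Givens lemmas of
  `YangMills/Theorems/PencilRigidityPlanarToEuclideanSO4.lean`): three Givens steps in the planes `(0,1)`,
  `(1,2)`, `(2,3)` send `R e₃` to `e₃`, two more (fixing `e₃`) send the image of `e₂` to `e₂`, and what
  remains fixes `e₂, e₃`.

References: Osterwalder–Schrader 1973 §2 (`⁰𝒮`, Euclidean action on test functions); Montvay–Münster 1994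
§4.2, App. A (hypercubic group on Dirac spinors); Osterwalder–Seiler 1978 §2 (lattice QCD functional).
-/

noncomputable section

-- Mathlib's `SimplexCategory` instance `Fintype (Fin (x.len + 1))` matches `Fintype (Fin 4)` (tree-known
-- workaround, as in `PencilRigidityPlanarToEuclideanSO4.lean`).
attribute [-instance] SimplexCategory.instFintypeToTypeOrderHomFinHAddNatLenOfNat

namespace Summit.QuantumFields.QCD.Cruxes.RotationRestoration.Birth

open scoped BigOperators Topology SchwartzMap
open Filter
open Literature.MathematicalPhysics.QuantumLattice Literature.MathematicalPhysics.AQFT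
  Literature.MathematicalPhysics.QuantumFieldTheory

/-- `ℝ⁴` (file-local notation). -/
local notation "E4" => EuclideanSpace ℝ (Fin 4)

/-! ## Vocabulary -/

/-- **The lattice tie** (convergence clause of the crux, verbatim): `S` is the `k → ∞` limit of the honest
lattice QCD `n`-point functions `qcdLatticeSchwinger sch k` on off-diagonal real tensors, `n ≠ 0`. -/
def IsLatticeLimit {Nf : ℕ} (sch : QCDScheme Nf)
    (S : LabelledSchwingerFamily (QCDField Nf) E4) : Prop :=
  ∀ n : ℕ, n ≠ 0 → ∀ (σ : Fin n → QCDField Nf) (f : Fin n → 𝓢(E4, ℝ)) (F : 𝓢((Fin n → E4), ℂ)),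
    IsTensorOf F (fun i => ofRealTest (f i)) → IsOffDiagonal F →
      Tendsto (fun k : ℕ => qcdLatticeSchwinger sch k n σ f) atTop (𝓝 (S n σ F))

/-- **A separated family** of real one-point test functions: every `fᵢ` is compactly supported and the
topological supports are pairwise disjoint (so `f₁ ⊗ ⋯ ⊗ fₙ` vanishes near the coincidence locus). -/
def IsSeparated {n : ℕ} (f : Fin n → 𝓢(E4, ℝ)) : Prop :=
  (∀ i, HasCompactSupport (f i : E4 → ℝ)) ∧
    ∀ i j, i ≠ j → Disjoint (tsupport (f i : E4 → ℝ)) (tsupport (f j : E4 → ℝ))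

/-- **The axis permutation `π` as a linear isometry of `ℝ⁴`**: `(axisPerm π v)_j = v_{π⁻¹ j}`, so that
`axisPerm π eᵢ = e_{π i}` (Mathlib `LinearIsometryEquiv.piLpCongrLeft`). -/
abbrev axisPerm (π : Equiv.Perm (Fin 4)) : E4 ≃ₗᵢ[ℝ] E4 :=
  LinearIsometryEquiv.piLpCongrLeft 2 ℝ ℝ π

/-- **The coordinate `SO(2)₀₁`**: determinant-one linear isometries fixing `e₂` and `e₃` (all rotations of
the `(x₀,x₁)`-plane). -/
def IsPlanar (R : E4 ≃ₗᵢ[ℝ] E4) : Prop :=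
  LinearMap.det (R.toLinearEquiv : E4 →ₗ[ℝ] E4) = 1 ∧
    R (EuclideanSpace.single 2 1) = EuclideanSpace.single 2 1 ∧
      R (EuclideanSpace.single 3 1) = EuclideanSpace.single 3 1

/-! ## The six stub statements of the skeleton (Props; proved in sibling files) -/

/-- **(S1a) Exact covariance of the lattice `n`-point functions under an axis permutation with a
`γ₅`-preserving spinor intertwiner.**  For every scheme, every cutoff `k`, every axis permutation `π` with
spinor matrices `S γ_μ S' = γ_{π μ}`, `S S' = 1` (`IsSpinorIntertwiner`) and `S γ₅ S' = γ₅` (available exactly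
for the even permutations, S1c), and all real test functions,
`⟨∏ᵢ Φ^{σᵢ}(fᵢ ∘ P_π⁻¹)⟩_k = ⟨∏ᵢ Φ^{σᵢ}(fᵢ)⟩_k`.  Expected proof: `qcdLatticeSchwinger` is the honest functional
`qcdTorusExpect` of the ordered product of smeared insertions; the tree's `qcdTorusExpect_quarkAxisPerm`
(`⟨(π,S)·X(π⁻¹·U)⟩ = ⟨X⟩`); `(π,S)` carries the glue density at `x` to the one at `π x`
(`LatticeRep.curvature_F_perm_torusLift`) and — by `S γ₅ S' = γ₅` — `P_{fg}(x)` to `P_{fg}(π x)`, fixes the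
scalars `shift_s(k)`; the site sum over the `π`-invariant box is re-indexed and
`f(a_k π⁻¹ y) = (f ∘ P_π⁻¹)(a_k y)` (`piLpCongrLeft_symm_smul_siteToE`).  (Montvay–Münster 1994 §4.2.) -/
def LatticePermCovariance : Prop :=
  ∀ (Nf : ℕ) (sch : QCDScheme Nf) (k : ℕ) (π : Equiv.Perm (Fin 4)) (Sm Sm' : Matrix (Fin 4) (Fin 4) ℂ),
    IsSpinorIntertwiner π Sm Sm' → Sm * gammaFive * Sm' = gammaFive →
      ∀ (n : ℕ) (σ : Fin n → QCDField Nf) (f : Fin n → 𝓢(E4, ℝ)),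
        qcdLatticeSchwinger sch k n σ (fun i => linActTest (𝕜 := ℝ) (axisPerm π) (f i)) =
          qcdLatticeSchwinger sch k n σ f

/-- **(S1b) An exact lattice symmetry of the scheme passes to every tied limit, on separated tensors.**
If the linear isometry `A` leaves every lattice `n`-point function of `sch` invariant at every cutoff
(`fᵢ ↦ fᵢ ∘ A⁻¹`), then every `S` tied to `sch` has `S n σ (F ∘ A⁻¹) = S n σ F` for separated real tensors
`F = ⊗ fᵢ`.  Expected proof: `F ∘ A⁻¹` is the tensor of the `fᵢ ∘ A⁻¹`; separated tensors and their images
are off-diagonal (support criterion); the tie gives both values as limits of the same sequence; limits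
in `ℂ` are unique; `n = 0` is trivial. -/
def LatticeInvariancePassesToLimit : Prop :=
  ∀ (Nf : ℕ) (sch : QCDScheme Nf) (S : LabelledSchwingerFamily (QCDField Nf) E4), IsLatticeLimit sch S →
    ∀ A : E4 ≃ₗᵢ[ℝ] E4,
      (∀ (k n : ℕ) (σ : Fin n → QCDField Nf) (f : Fin n → 𝓢(E4, ℝ)),
        qcdLatticeSchwinger sch k n σ (fun i => linActTest (𝕜 := ℝ) A (f i)) =
          qcdLatticeSchwinger sch k n σ f) →
      ∀ (n : ℕ) (σ : Fin n → QCDField Nf) (f : Fin n → 𝓢(E4, ℝ)), IsSeparated f →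
        ∀ F : 𝓢((Fin n → E4), ℂ), IsTensorOf F (fun i => ofRealTest (f i)) →
          S n σ (linActMulti A F) = S n σ F

/-- **(S1c) Even axis permutations have `γ₅`-preserving spinor intertwiners.**  Expected proof: swap
induction — `(1,1)` intertwines the identity; the tree's transposition spinors `γ₅(γ_μ − γ_ν)`
(`transpositionSpinor_intertwines`) anticommute with `γ₅`; intertwiners compose
(`IsSpinorIntertwiner.trans`) and `S γ₅ S'` picks up the factor `sign π`.  (Montvay–Münster 1994 App. A.) -/
def EvenPermSpinor : Prop :=
  ∀ π : Equiv.Perm (Fin 4), Equiv.Perm.sign π = 1 →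
    ∃ Sm Sm' : Matrix (Fin 4) (Fin 4) ℂ, IsSpinorIntertwiner π Sm Sm' ∧ Sm * gammaFive * Sm' = gammaFive

/-- **(S2) Planar Ward restoration on separated tensors** (THE hard stub of the line; open problem).  Under
the crux's hypotheses — two-loop asymptotic scaling, bare masses eventually on the physical branch, a
uniform lattice mass gap, and the tie — `S n σ (F ∘ R⁻¹) = S n σ F` for every determinant-one isometry `R`
fixing `e₂, e₃` and every separated real tensor `F`.  Intended engine (route header, card K2/K4): the
`θ`-derivative of `S n σ (F ∘ R_θ⁻¹)` is the limit of the lattice rotation Ward identity in the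
`(x₀,x₁)`-plane, whose hypercubic-to-`O(4)` defect is `a_k²` times an insertion of dimension-6 operators
(Caracciolo–Curci–Menotti–Pelissetto lattice energy–momentum tensor); lattice-gap clustering bounds the
volume sum and `k`-uniform insertion bounds (an unbuilt UV output) kill the `a_k²`.  Why it might fail:
stated for every `N_f` (≥ 17 is a junk regime), all `z_s(k)`, every sequential limit. -/
def PlanarWardOnSeparatedTensors : Prop :=
  ∀ (Nf : ℕ) (sch : QCDScheme Nf), sch.HasAsymptoticScaling →
    (∀ fl : Fin Nf, ∀ᶠ k in atTop, -1 < sch.mq fl k) →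
      (∃ Δ : ℝ, 0 < Δ ∧ sch.HasLatticeMassGap Δ) →
        ∀ S : LabelledSchwingerFamily (QCDField Nf) E4, IsLatticeLimit sch S →
          ∀ (n : ℕ) (σ : Fin n → QCDField Nf) (R : E4 ≃ₗᵢ[ℝ] E4), IsPlanar R →
            ∀ f : Fin n → 𝓢(E4, ℝ), IsSeparated f →
              ∀ F : 𝓢((Fin n → E4), ℂ), IsTensorOf F (fun i => ofRealTest (f i)) →
                S n σ (linActMulti R F) = S n σ F

/-- **(S3) Separated real tensors are total in `⁰𝒮`.**  Two continuous linear functionals on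
`𝓢((ℝ⁴)ⁿ, ℂ)` agreeing on the complexified real tensors with compactly supported, pairwise disjoint factors
agree on every test function flat on the coincidence locus (`IsOffDiagonal`).  Expected proof: the engine of
`StableActionBridge.Sketch.stub_offDiagonalTensorDensity` (`exists_separated_tendsto_of_isOffDiagonal`,
lattice partition of unity, `mem_closure_span_boxTensors` over pairwise disjoint bounded blocks, whose box
tensors ARE separated families), then linearity and continuity.  (Osterwalder–Schrader 1973 §2.) -/
def SeparatedTensorsTotal : Prop :=
  ∀ (n : ℕ) (T₁ T₂ : 𝓢((Fin n → E4), ℂ) →L[ℂ] ℂ),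
    (∀ f : Fin n → 𝓢(E4, ℝ), IsSeparated f →
      ∀ F : 𝓢((Fin n → E4), ℂ), IsTensorOf F (fun i => ofRealTest (f i)) → T₁ F = T₂ F) →
      ∀ F : 𝓢((Fin n → E4), ℂ), IsOffDiagonal F → T₁ F = T₂ F

/-- **(S4) `SO(4)` from the three coordinate `SO(2)`'s** (pure Euclidean geometry).  A predicate on the
linear isometries of `ℝ⁴` closed under `trans` and `symm`, containing every determinant-one isometry
fixing `(e₂,e₃)`, every one fixing `(e₀,e₃)` and every one fixing `(e₀,e₁)`, contains every determinant-one
isometry.  Proved below (`stub_so4FromCoordinatePlanes`): the Givens tail of the landed `PlanarToEuclidean.so4_generation`. -/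
def SO4FromCoordinatePlanes : Prop :=
  ∀ P : (E4 ≃ₗᵢ[ℝ] E4) → Prop,
    (∀ A B, P A → P B → P (A.trans B)) → (∀ A, P A → P A.symm) →
      (∀ A : E4 ≃ₗᵢ[ℝ] E4, LinearMap.det (A.toLinearEquiv : E4 →ₗ[ℝ] E4) = 1 →
        A (EuclideanSpace.single 2 1) = EuclideanSpace.single 2 1 →
          A (EuclideanSpace.single 3 1) = EuclideanSpace.single 3 1 → P A) →
      (∀ A : E4 ≃ₗᵢ[ℝ] E4, LinearMap.det (A.toLinearEquiv : E4 →ₗ[ℝ] E4) = 1 →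
        A (EuclideanSpace.single 0 1) = EuclideanSpace.single 0 1 →
          A (EuclideanSpace.single 3 1) = EuclideanSpace.single 3 1 → P A) →
      (∀ A : E4 ≃ₗᵢ[ℝ] E4, LinearMap.det (A.toLinearEquiv : E4 →ₗ[ℝ] E4) = 1 →
        A (EuclideanSpace.single 0 1) = EuclideanSpace.single 0 1 →
          A (EuclideanSpace.single 1 1) = EuclideanSpace.single 1 1 → P A) →
      ∀ R : E4 ≃ₗᵢ[ℝ] E4, LinearMap.det (R.toLinearEquiv : E4 →ₗ[ℝ] E4) = 1 → P R

/-! ## Proof of (S4): Givens generation of `SO(4)` from three coordinate `SO(2)`'s -/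

section Generation

open Summit.QuantumFields.YangMills.Theorems.PlanarToEuclidean

/-- The axis vector `eᵢ` (file-local notation). -/
local notation:max "𝐞" i:max => (EuclideanSpace.single (i : Fin 4) (1 : ℝ) : EuclideanSpace ℝ (Fin 4))

/-- The determinant of a linear isometry of `ℝ⁴` (file-local notation). -/
local notation:max "𝐝" R:max =>
  LinearMap.det (LinearIsometryEquiv.toLinearEquiv (R : EuclideanSpace ℝ (Fin 4) ≃ₗᵢ[ℝ] EuclideanSpace ℝ (Fin 4)) :
    EuclideanSpace ℝ (Fin 4) →ₗ[ℝ] EuclideanSpace ℝ (Fin 4))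

/-- **(S4) proved: `SO(4)` from the coordinate `SO(2)`'s of the planes `(0,1)`, `(1,2)`, `(2,3)`.**  A
predicate on the linear isometries of `ℝ⁴` closed under composition and inverses that holds on every
determinant-one isometry fixing `(e₂,e₃)`, on every one fixing `(e₀,e₃)` and on every one fixing `(e₀,e₁)`
holds on every determinant-one isometry.  Proof (adapted verbatim from the tail of
`PlanarToEuclidean.so4_generation`): three Givens steps (`givens`) send `R e₃` to `e₃`, two more fixing
`e₃` send the image of `e₂` to `e₂`; the remainder fixes `e₂, e₃`; unwind with the group property. -/
theorem stub_so4FromCoordinatePlanes : SO4FromCoordinatePlanes := by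
  intro P hmul hinv hplanar stab03 stab01 R hR
  have h01 : (0 : Fin 4) ≠ 1 := by decide
  have h12 : (1 : Fin 4) ≠ 2 := by decide
  have h23 : (2 : Fin 4) ≠ 3 := by decide
  -- Step A: move `R e₃` to `e₃`
  set v : EuclideanSpace ℝ (Fin 4) := R (𝐞 3) with hv
  have hvn : ‖v‖ = 1 := by rw [hv, LinearIsometryEquiv.norm_map, norm_e]
  obtain ⟨G1, hG1det, hG1fix, hG1a, -, hG1c⟩ := givens 0 1 h01 v
  obtain ⟨G2, hG2det, hG2fix, hG2a, -, hG2c⟩ := givens 1 2 h12 (G1 v)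
  obtain ⟨G3, hG3det, hG3fix, hG3a, hG3b, hG3c⟩ := givens 2 3 h23 (G2 (G1 v))
  have hPG1 : P G1 := hplanar G1 hG1det (hG1fix 2 (by decide) (by decide)) (hG1fix 3 (by decide) (by decide))
  have hPG2 : P G2 := stab03 G2 hG2det (hG2fix 0 (by decide) (by decide)) (hG2fix 3 (by decide) (by decide))
  have hPG3 : P G3 := stab01 G3 hG3det (hG3fix 0 (by decide) (by decide)) (hG3fix 1 (by decide) (by decide))
  have hT3 : G3 (G2 (G1 v)) = 𝐞 3 := by
    refine eq_e_of_norm_one (by rw [LinearIsometryEquiv.norm_map, LinearIsometryEquiv.norm_map,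
      LinearIsometryEquiv.norm_map, hvn]) 3 (fun c hc => ?_) hG3b
    rcases four_cases c with rfl | rfl | rfl | rfl
    · rw [hG3c 0 (by decide) (by decide), hG2c 0 (by decide) (by decide), hG1a]
    · rw [hG3c 1 (by decide) (by decide), hG2a]
    · exact hG3a
    · exact absurd rfl hc
  set T : EuclideanSpace ℝ (Fin 4) ≃ₗᵢ[ℝ] EuclideanSpace ℝ (Fin 4) := G1.trans (G2.trans G3) with hT
  have hPT : P T := hmul _ _ hPG1 (hmul _ _ hPG2 hPG3)
  have hTdet : 𝐝 T = 1 := by rw [hT, det_trans, det_trans, hG1det, hG2det, hG3det]; norm_num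
  have hTv : T v = 𝐞 3 := by rw [hT, LinearIsometryEquiv.trans_apply, LinearIsometryEquiv.trans_apply, hT3]
  -- `R' = T ∘ R` fixes `e₃`
  set R' : EuclideanSpace ℝ (Fin 4) ≃ₗᵢ[ℝ] EuclideanSpace ℝ (Fin 4) := R.trans T with hR'
  have hR'det : 𝐝 R' = 1 := by rw [hR', det_trans, hR, hTdet, one_mul]
  have hR'3 : R' (𝐞 3) = 𝐞 3 := by rw [hR', LinearIsometryEquiv.trans_apply, ← hv, hTv]
  -- Step B: move `R' e₂` to `e₂` inside the stabiliser of `e₃`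
  set u : EuclideanSpace ℝ (Fin 4) := R' (𝐞 2) with hu
  have hun : ‖u‖ = 1 := by rw [hu, LinearIsometryEquiv.norm_map, norm_e]
  have hu3 : u 3 = 0 := by
    rw [← inner_e_left, ← hR'3, hu, LinearIsometryEquiv.inner_map_map, inner_e_e, if_neg h23.symm]
  obtain ⟨G4, hG4det, hG4fix, hG4a, -, hG4c⟩ := givens 0 1 h01 u
  obtain ⟨G5, hG5det, hG5fix, hG5a, hG5b, hG5c⟩ := givens 1 2 h12 (G4 u)
  have hPG4 : P G4 := hplanar G4 hG4det (hG4fix 2 (by decide) (by decide)) (hG4fix 3 (by decide) (by decide))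
  have hPG5 : P G5 := stab03 G5 hG5det (hG5fix 0 (by decide) (by decide)) (hG5fix 3 (by decide) (by decide))
  have hT2 : G5 (G4 u) = 𝐞 2 := by
    refine eq_e_of_norm_one (by rw [LinearIsometryEquiv.norm_map, LinearIsometryEquiv.norm_map, hun]) 2
      (fun c hc => ?_) hG5b
    rcases four_cases c with rfl | rfl | rfl | rfl
    · rw [hG5c 0 (by decide) (by decide), hG4a]
    · exact hG5a
    · exact absurd rfl hc
    · rw [hG5c 3 (by decide) (by decide), hG4c 3 (by decide) (by decide), hu3]
  set T' : EuclideanSpace ℝ (Fin 4) ≃ₗᵢ[ℝ] EuclideanSpace ℝ (Fin 4) := G4.trans G5 with hT'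
  have hPT' : P T' := hmul _ _ hPG4 hPG5
  have hT'det : 𝐝 T' = 1 := by rw [hT', det_trans, hG4det, hG5det, one_mul]
  have hT'3 : T' (𝐞 3) = 𝐞 3 := by
    rw [hT', LinearIsometryEquiv.trans_apply, hG4fix 3 (by decide) (by decide), hG5fix 3 (by decide) (by decide)]
  have hT'u : T' u = 𝐞 2 := by rw [hT', LinearIsometryEquiv.trans_apply, hT2]
  -- `R'' = T' ∘ R'` fixes `e₂` and `e₃`, hence lies in (H01)
  set R'' : EuclideanSpace ℝ (Fin 4) ≃ₗᵢ[ℝ] EuclideanSpace ℝ (Fin 4) := R'.trans T' with hR''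
  have hR''det : 𝐝 R'' = 1 := by rw [hR'', det_trans, hR'det, hT'det, one_mul]
  have hR''2 : R'' (𝐞 2) = 𝐞 2 := by rw [hR'', LinearIsometryEquiv.trans_apply, ← hu, hT'u]
  have hR''3 : R'' (𝐞 3) = 𝐞 3 := by rw [hR'', LinearIsometryEquiv.trans_apply, hR'3, hT'3]
  have hPR'' : P R'' := hplanar R'' hR''det hR''2 hR''3
  -- unwind: `R = T⁻¹ T'⁻¹ R''`
  have hReq : R = R''.trans (T'.symm.trans T.symm) := by
    ext x
    simp [hR'', hR']
  rw [hReq]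
  exact hmul _ _ hPR'' (hmul _ _ (hinv _ hPT') (hinv _ hPT))

end Generation

end Summit.QuantumFields.QCD.Cruxes.RotationRestoration.Birth

end
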